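import Summits.QuantumFields.YangMills.Theorems.BalabanUVNodesN15KingModelFullPropagatorGradRateProfile
import Summits.QuantumFields.YangMills.Theorems.BalabanUVNodesN15KingModelFullPropagatorRatePowerLaw

/-!
# BalabanUVNodes ∕ N15 — THE KING-MODEL RUNG, CURVED EDITION (PART S-d): THE TWO-SPACING η-RATE POWER LAW OF THE GRADIENT OF THE FULL
# `A = 0` FLUCTUATION PROPAGATOR — `|∂^{η′}_μG^{η′}_{K+n}(x′, y′) − ∂^η_μG^η_K(x, y)| ≤ C·|x′ − y′|^{1−(d+1)}·(η∕|x′ − y′|)^{γ∕2}` for ALL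
# pairs with `|x′ − y′| ≥ η`: King's (3.73) second line summed over (2.17), i.e. the (W1)-type gradient profile WITH the scale-covariant
# rate factor, UNIFORMLY in `K`, `n`, the volume and the mass
# (Track A, DAG node N15 = NE2; FAN-OUT v1.1 §N15 s3 «KING-MODEL RUNG … + the one-line statement of what the curved case adds»)

HONEST FRAMING.  Count-neutral kernel bookkeeping (cell `pub-ymgap`, seat `pub-ymgap-dag-n15-e` g8; `--supports stmt-QuantumFields-20296
--as helper` = K3⁵ `SpineGivenEndpointR13SepCoP`, WORDS-141).  TEMPLATE LITERATURE, `A = 0`: C. King's scalar U(1)-Higgs MODEL on finite tori ([King1986]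
§2.2 p. 653 (2.13)–(2.17), p. 654 (2.20), Prop. 3.9 (3.73) p. 665 second line «`|∂^{η′}_μG^{η′}_{(j)}(x′, y′) − ∂^η_μG^η_{(j)}(x, y)| ≤
CL^{−γk}(L^jη)^{1−d−γ}exp[−δ₀(L^jη)^{−1}|x − y|]`», King's `d` = this file's `d + 1`), NOT Bałaban's covariant objects; the statement below is the
(2.17)-SUMMED SHAPE of (3.73) line 2 for King's (2.13) at `A = 0`, NOT a printed proposition; NE2⁺ is NOT PRINTED and not proved here; NOT a
node discharge; nothing continuum ∕ ℝ⁴ ∕ OS ∕ mass-gap ∕ Clay.  0 `sorry`, 0 `def`, standard axioms.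

THE POINT.  Part S-c (`fullPropD_rateProfile_unif`) proved the all-pairs rate profile of the gradient pair; THIS FILE sums it with part S-b's
§1 (`levelSum_rate_le` at `p = d`, `unpairedSum_le` at `p = d`) on the resolved pairs `r′ ≥ L^n`:
* ★★★ **`fullPropD_ratePowerLaw_unif`** (`1 ≤ d`, `0 ≤ γ < 1`): `∃ C > 0 ∀ K ≥ 1 ∀ n ≥ 1 ∀ cube 2L^e ∀ 0 < m² ≤ m₀² ∀ μ ∀ x′ y′` with
  `r′ = |x′ − y′|_{fine L^nL^K M} ≥ L^n` (`x = underPtN x′`):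
  `|L^nL^K[G′(x′+e_μ, y′) − G′(x′, y′)] − L^K[G(x+e_μ, y) − G(x, y)]| ≤ C·(L^nL^K∕r′)^{d}·(L^n∕r′)^{γ∕2}` — in unit coordinates
  `C·|x′ − y′|^{1−(d+1)}·(η∕|x′ − y′|)^{γ∕2}`: the (3.63) gradient singularity (part R-c, the (W1) shape) times the scale-covariant rate factor
  (part S-b; `T4EtaRate.rateFactor`), UNIFORM in `K`, `n`, the volume and the mass.  Part O-b′ is its unit-scale case.
* §2 ★★ **`fullProp_ratePowerLaw_all`** (`d ≥ 2`, `0 ≤ γ ≤ 1`) and **`fullPropD_ratePowerLaw_all`** (`d ≥ 1`, `0 ≤ γ < 1`) — the SAME displays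
  for EVERY pair `x′ ≠ y′`, resolved or not: below the coarse spacing (`1 ≤ r′ < L^n`) the rate factor `(L^n∕r′)^{γ∕2}` is `≥ 1` and the two
  runs are bounded separately by the fine run's singularity (parts R-b ∕ R-c at `K + n` levels) and the coarse diagonal order
  `(L^K)^{p} ≤ (L^nL^K∕r′)^{p}` (parts R-b ∕ R-c) — ONE display for the two-spacing difference of King's full `A = 0` propagator and of its
  gradient on all distinct pairs, uniform in `K`, `n`, the volume and the mass.
* §3 (v1.1, append-only) `fullPropD2_ratePowerLaw_unif` ∕ `fullPropD2_ratePowerLaw_all` — the `∇_y` twins (derivative in the SOURCE point, coarse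
  step on the coarse lattice): §1∕§2 at the swapped pair through `constrainedProp_symm` and `tdistT_symm` — the spelling «`∇_yG_k(x, y)`» of (W1).
WHAT THE CURVED CASE ADDS (one line): the same for Bałaban's `∇_UG_k(U)` pair uniformly over `Reg335` — the kernel-level, all-resolved-pairs η-rate
of the gradient that the (W1)∕NE3 wall would consume, not printed as an η-difference.
HONEST SCOPE.  (i) `A = 0`, periodic b.c., odd `L ≥ 3`, `0 < m² ≤ m₀²`, cubes `2L^e`; (ii) lattice units of the respective levels; (iii) `K, n ≥ 1`,
`d ≥ 1` (gradient) ∕ `d ≥ 2` (kernel); (iv) §1 on resolved pairs `r′ ≥ L^n`, §2 on all `x′ ≠ y′` (at `x′ = y′` the fine diagonal is of order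
`(L^nL^K)^{p}`, parts O-c ∕ R-b — no rate); (v) not Bałaban's `G_k(U)`; not a discharge.
Locators: [King1986] C. King, CMP **102** (1986) 649–677: (2.13)–(2.17) p. 653, (2.20) p. 654, Theorem 3.3 p. 655, (3.7) p. 656, Prop. 3.7
(3.63) p. 663, Prop. 3.8 (3.71) p. 664, Prop. 3.9 (3.73) p. 665, (4.42)–(4.43) p. 675; [B9] = [Balaban1985BackgroundPropagators] Thm 3.14
pp. 426–427 (template).
-/

noncomputable section

namespace Summit.QuantumFields.YangMills.BalabanUVNodes.N15KingModelRung.Curved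

open Real Finset Matrix
open Literature.MathematicalPhysics.QuantumFieldTheory.Balaban1983to89.B5Prop11Plancherel (Tor fine unitVec)
open Literature.MathematicalPhysics.QuantumFieldTheory.King1986 (aK aK_pos)
open Literature.MathematicalPhysics.QuantumFieldTheory.King1986.Torus (constrainedProp tdistT tdistT_nonneg)

variable {d : ℕ} (L : ℕ) [NeZero L]

/-- **THE TWO-SPACING η-RATE POWER LAW OF THE GRADIENT OF KING'S FULL `A = 0` FLUCTUATION PROPAGATOR, ALL RESOLVED PAIRS** (`d ≥ 1`,
`0 ≤ γ < 1`): for odd `L ≥ 3`, `a > 0`, `m₀² ≥ 0` there is `C > 0` (a function of `d, L, a, m₀², γ`) such that for EVERY `K ≥ 1`, `n ≥ 1`, cube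
`M_μ = 2L^e`, mass `0 < m² ≤ m₀²`, direction `μ` and ALL fine points `x′, y′` of the `(K+n)`-level run at fine distance `r′ ≥ L^n` (`|x′ − y′| ≥ η`),
with `x = underPtN x′`, `y = underPtN y′`:
`|L^nL^K[G^{η′}_{K+n}(x′+e_μ, y′) − G^{η′}_{K+n}(x′, y′)] − L^K[G^η_K(x+e_μ, y) − G^η_K(x, y)]| ≤ C·(L^nL^K∕r′)^{d}·(L^n∕r′)^{γ∕2}` =
`C·|x′ − y′|^{1−(d+1)}·(η∕|x′ − y′|)^{γ∕2}` in unit coordinates — (3.73) line 2 summed, UNIFORM in `K`, `n`, the volume and the mass (part S-c +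
part S-b §1 at `p = d`).  NOT a printed proposition; nothing here is Bałaban's `∇G_k(U)`.
[cite: King1986, (2.13)–(2.17) p.653, (2.20) p.654, Prop. 3.7 (3.63) p.663, Prop. 3.8 (3.71) p.664, Prop. 3.9 (3.73) p.665, (4.42)–(4.43) p.675; Balaban1985BackgroundPropagators, Thm 3.14 pp.426–427] -/
theorem fullPropD_ratePowerLaw_unif (hd : 1 ≤ d) (hLodd : Odd L) (hL : 2 ≤ L) {a : ℝ} (ha : 0 < a) {m0sq : ℝ} (hm0 : 0 ≤ m0sq)
    {γ : ℝ} (hγ0 : 0 ≤ γ) (hγ1 : γ < 1) :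
    ∃ C : ℝ, 0 < C ∧ ∀ (K : ℕ), 1 ≤ K → ∀ (n : ℕ), 1 ≤ n →
      ∀ (e : ℕ) (M : Fin (d + 1) → ℕ) [∀ μ, NeZero (M μ)], (∀ μ, M μ = 2 * L ^ e) →
      ∀ (msq : ℝ), 0 < msq → msq ≤ m0sq →
      ∀ (μ : Fin (d + 1)) (x' y' : Tor (fine (L ^ n * L ^ K) M)), ((L ^ n : ℕ) : ℝ) ≤ tdistT (fine (L ^ n * L ^ K) M) x' y' →
        |((L ^ n * L ^ K : ℕ) : ℝ) *
              (constrainedProp (L ^ n * L ^ K) M (aK a L (K + n)) (((L ^ n * L ^ K : ℕ) : ℝ) ^ 2) msq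
                  (x' + unitVec (fine (L ^ n * L ^ K) M) μ) y'
                - constrainedProp (L ^ n * L ^ K) M (aK a L (K + n)) (((L ^ n * L ^ K : ℕ) : ℝ) ^ 2) msq x' y')
            - ((L ^ K : ℕ) : ℝ) *
              (constrainedProp (L ^ K) M (aK a L K) (((L ^ K : ℕ) : ℝ) ^ 2) msq
                  (underPtN L K n M x' + unitVec (fine (L ^ K) M) μ) (underPtN L K n M y')
                - constrainedProp (L ^ K) M (aK a L K) (((L ^ K : ℕ) : ℝ) ^ 2) msq
                  (underPtN L K n M x') (underPtN L K n M y'))|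
          ≤ C * (((L ^ n * L ^ K : ℕ) : ℝ) / tdistT (fine (L ^ n * L ^ K) M) x' y') ^ d
              * (((L ^ n : ℕ) : ℝ) / tdistT (fine (L ^ n * L ^ K) M) x' y') ^ (γ / 2) := by
  have hLr : (2 : ℝ) ≤ L := by exact_mod_cast hL
  have hL0 : (0 : ℝ) < L := by linarith
  have hp : 1 ≤ d := hd
  have hs0 : 0 ≤ γ / 2 := by linarith
  have hs1 : γ / 2 ≤ 1 := by linarith [hγ1.le]
  obtain ⟨C₀, δ, hC₀, hδ, H⟩ := fullPropD_rateProfile_unif (d := d) L hLodd hL ha hm0 hγ0 hγ1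
  -- the two summation constants
  set A₁ : ℝ := 2 * δ ^ (-(γ / 2)) * ((2 * (d + 1).factorial / (δ / 2 / L) ^ (d + 1) + 2) / (L : ℝ) ^ d) with hA₁
  set A₂ : ℝ := 2 * (d + 1).factorial / δ ^ (d + 1) with hA₂
  have hA₁0 : 0 < A₁ := by
    have : 0 < δ ^ (-(γ / 2)) := Real.rpow_pos_of_pos hδ _
    positivity
  have hA₂0 : 0 < A₂ := by positivity
  refine ⟨C₀ * (A₁ + A₂), by positivity, ?_⟩
  intro K hK n hn e M _ hM msq hmsq hcap μ x' y' hres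
  have h := H K hK n hn e M hM msq hmsq hcap μ x' y'
  set r' : ℝ := tdistT (fine (L ^ n * L ^ K) M) x' y' with hr'def
  set Ln : ℝ := ((L ^ n : ℕ) : ℝ) with hLndef
  have hLn : Ln = (L : ℝ) ^ n := by rw [hLndef]; push_cast; ring
  have hLn0 : 0 < Ln := by rw [hLn]; positivity
  have hr'0 : 0 < r' := lt_of_lt_of_le hLn0 hres
  -- the resolved distance in coarse-spacing units `ρ = r′∕L^n ≥ 1`
  set ρ : ℝ := r' / Ln with hρdef
  have hρ : 1 ≤ ρ := by rw [hρdef, le_div_iff₀ hLn0, one_mul]; exact hres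
  have hρ0 : 0 < ρ := by linarith
  have hNc : ((L ^ n * L ^ K : ℕ) : ℝ) = Ln * (L : ℝ) ^ K := by rw [hLndef]; push_cast; ring
  -- the exponents of part S-a in the variable `ρ`: `r′·L^m∕N′ = ρ·L^m∕L^K`
  have hexp : ∀ m : ℕ, r' * (L : ℝ) ^ m / ((L ^ n * L ^ K : ℕ) : ℝ) = ρ * (L : ℝ) ^ m / (L : ℝ) ^ K := fun m => by
    rw [hNc, hρdef]
    field_simp
  have hΛφ : (L : ℝ) ^ (d + 1) / (L : ℝ) ^ 2 * L * (L : ℝ) ^ (γ / 2) = (L : ℝ) ^ d * (L : ℝ) ^ (γ / 2) := by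
    rw [LamL_eq_pow L hL]
  have hPS : ((L : ℝ) ^ (-(γ / 2))) ^ K
        * ∑ i ∈ Finset.range K, ((L : ℝ) ^ (d + 1) / (L : ℝ) ^ 2 * L * (L : ℝ) ^ (γ / 2)) ^ i
            * Real.exp (-(δ * (r' * (L : ℝ) ^ i / ((L ^ n * L ^ K : ℕ) : ℝ))))
      = ((L : ℝ) ^ (-(γ / 2))) ^ K
        * ∑ i ∈ Finset.range K, ((L : ℝ) ^ d * (L : ℝ) ^ (γ / 2)) ^ i
            * Real.exp (-(δ * (ρ * (L : ℝ) ^ i / (L : ℝ) ^ K))) := by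
    congr 1
    exact Finset.sum_congr rfl fun i _ => by rw [hΛφ, hexp]
  have hUS : ∑ i ∈ Finset.range n, ((L : ℝ) ^ (d + 1) / (L : ℝ) ^ 2 * L) ^ (K + i)
          * Real.exp (-(δ * (r' * (L : ℝ) ^ (K + i) / ((L ^ n * L ^ K : ℕ) : ℝ))))
      = ∑ i ∈ Finset.range n, ((L : ℝ) ^ d) ^ (K + i) * Real.exp (-(δ * (ρ * (L : ℝ) ^ (K + i) / (L : ℝ) ^ K))) :=
    Finset.sum_congr rfl fun i _ => by rw [LamL_eq_pow L hL, hexp]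
  rw [hPS, hUS] at h
  -- §1
  have h1 := levelSum_rate_le hLr hδ hp hs0 hs1 K hρ
  have h2 := unpairedSum_le hLr hδ d K n hρ
  -- `ρ⁻¹ ≤ ρ^{−γ∕2}` (`ρ ≥ 1`)
  have hρinv : ρ⁻¹ ≤ ρ ^ (-(γ / 2)) := by
    rw [← Real.rpow_neg_one]
    exact Real.rpow_le_rpow_of_exponent_le hρ (by linarith)
  have hPow0 : 0 ≤ ((L : ℝ) ^ K / ρ) ^ d := by positivity
  have h2' : ∑ i ∈ Finset.range n, ((L : ℝ) ^ d) ^ (K + i) * Real.exp (-(δ * (ρ * (L : ℝ) ^ (K + i) / (L : ℝ) ^ K)))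
      ≤ A₂ * ((L : ℝ) ^ K / ρ) ^ d * ρ ^ (-(γ / 2)) :=
    h2.trans (mul_le_mul_of_nonneg_left hρinv (by positivity))
  -- the two factors of the display in the variable `ρ`
  have hF1 : ((L ^ n * L ^ K : ℕ) : ℝ) / r' = (L : ℝ) ^ K / ρ := by
    rw [hNc, hρdef]
    field_simp
  have hF2 : Ln / r' = ρ⁻¹ := by rw [hρdef, inv_div]
  have hF3 : (ρ⁻¹) ^ (γ / 2) = ρ ^ (-(γ / 2)) := by
    rw [Real.inv_rpow hρ0.le, Real.rpow_neg hρ0.le]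
  rw [hF1, hF2, hF3]
  calc |((L ^ n * L ^ K : ℕ) : ℝ) *
            (constrainedProp (L ^ n * L ^ K) M (aK a L (K + n)) (((L ^ n * L ^ K : ℕ) : ℝ) ^ 2) msq
                (x' + unitVec (fine (L ^ n * L ^ K) M) μ) y'
              - constrainedProp (L ^ n * L ^ K) M (aK a L (K + n)) (((L ^ n * L ^ K : ℕ) : ℝ) ^ 2) msq x' y')
          - ((L ^ K : ℕ) : ℝ) *
            (constrainedProp (L ^ K) M (aK a L K) (((L ^ K : ℕ) : ℝ) ^ 2) msq
                (underPtN L K n M x' + unitVec (fine (L ^ K) M) μ) (underPtN L K n M y')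
              - constrainedProp (L ^ K) M (aK a L K) (((L ^ K : ℕ) : ℝ) ^ 2) msq
                (underPtN L K n M x') (underPtN L K n M y'))|
      ≤ C₀ * (((L : ℝ) ^ (-(γ / 2))) ^ K
            * ∑ i ∈ Finset.range K, ((L : ℝ) ^ d * (L : ℝ) ^ (γ / 2)) ^ i
                * Real.exp (-(δ * (ρ * (L : ℝ) ^ i / (L : ℝ) ^ K)))
          + ∑ i ∈ Finset.range n, ((L : ℝ) ^ d) ^ (K + i)
                * Real.exp (-(δ * (ρ * (L : ℝ) ^ (K + i) / (L : ℝ) ^ K)))) := h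
    _ ≤ C₀ * (A₁ * ((L : ℝ) ^ K / ρ) ^ d * ρ ^ (-(γ / 2)) + A₂ * ((L : ℝ) ^ K / ρ) ^ d * ρ ^ (-(γ / 2))) := by
        refine mul_le_mul_of_nonneg_left (add_le_add ?_ h2') hC₀.le
        rw [hA₁]
        exact h1
    _ = C₀ * (A₁ + A₂) * ((L : ℝ) ^ K / ρ) ^ d * ρ ^ (-(γ / 2)) := by ring

/-! ## §2 All DISTINCT pairs: below the coarse spacing the rate factor exceeds one and parts R-b ∕ R-c take over -/

/-- **THE TWO-SPACING POWER LAW FOR ALL DISTINCT PAIRS** (`d ≥ 2`, `0 ≤ γ ≤ 1`): the bound of part S-b `fullProp_ratePowerLaw_unif`,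
`|G^{η′}_{K+n}(x′, y′) − G^η_K(x, y)| ≤ C·(L^nL^K∕r′)^{d−1}·(L^n∕r′)^{γ∕2}`, holds for EVERY `x′ ≠ y′` — on the resolved pairs `r′ ≥ L^n` it is
part S-b; below the coarse spacing (`1 ≤ r′ < L^n`, `|x′ − y′| < η`) the rate factor `(L^n∕r′)^{γ∕2} ≥ 1` and the two kernels are bounded
separately by the fine run's own singularity `(L^nL^K∕r′)^{d−1}` (part R-b `fullProp_powerLaw_unif` at `K + n` levels) and the coarse diagonal
order `(L^K)^{d−1} ≤ (L^nL^K∕r′)^{d−1}` (part R-b `fullProp_diag_le_unif`).  One display, uniform in `K`, `n`, the volume and the mass.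
[cite: King1986, (2.13)–(2.17) p.653, Prop. 3.7 (3.63) p.663, Prop. 3.9 (3.73) p.665] -/
theorem fullProp_ratePowerLaw_all (hd : 2 ≤ d) (hLodd : Odd L) (hL : 2 ≤ L) {a : ℝ} (ha : 0 < a) {m0sq : ℝ} (hm0 : 0 ≤ m0sq)
    {γ : ℝ} (hγ0 : 0 ≤ γ) (hγ1 : γ ≤ 1) :
    ∃ C : ℝ, 0 < C ∧ ∀ (K : ℕ), 1 ≤ K → ∀ (n : ℕ), 1 ≤ n →
      ∀ (e : ℕ) (M : Fin (d + 1) → ℕ) [∀ μ, NeZero (M μ)], (∀ μ, M μ = 2 * L ^ e) →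
      ∀ (msq : ℝ), 0 < msq → msq ≤ m0sq →
      ∀ x' y' : Tor (fine (L ^ n * L ^ K) M), x' ≠ y' →
        |constrainedProp (L ^ n * L ^ K) M (aK a L (K + n)) (((L ^ n * L ^ K : ℕ) : ℝ) ^ 2) msq x' y'
            - constrainedProp (L ^ K) M (aK a L K) (((L ^ K : ℕ) : ℝ) ^ 2) msq
                (underPtN L K n M x') (underPtN L K n M y')|
          ≤ C * (((L ^ n * L ^ K : ℕ) : ℝ) / tdistT (fine (L ^ n * L ^ K) M) x' y') ^ (d - 1)
              * (((L ^ n : ℕ) : ℝ) / tdistT (fine (L ^ n * L ^ K) M) x' y') ^ (γ / 2) := by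
  obtain ⟨C₀, hC₀, H₀⟩ := fullProp_ratePowerLaw_unif (d := d) L hd hLodd hL ha hm0 hγ0 hγ1
  obtain ⟨C₁, hC₁, H₁⟩ := fullProp_powerLaw_unif (d := d) L hd hLodd hL ha hm0
  obtain ⟨C₂, hC₂, H₂⟩ := fullProp_diag_le_unif (d := d) L hd hLodd hL ha hm0
  refine ⟨max C₀ (C₁ + C₂), lt_max_of_lt_left hC₀, ?_⟩
  intro K hK n hn e M _ hM msq hmsq hcap x' y' hxy
  set r' : ℝ := tdistT (fine (L ^ n * L ^ K) M) x' y' with hr'def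
  set Ln : ℝ := ((L ^ n : ℕ) : ℝ) with hLndef
  set N' : ℝ := ((L ^ n * L ^ K : ℕ) : ℝ) with hN'def
  have hr1 : 1 ≤ r' := one_le_tdistT_of_ne (fine (L ^ n * L ^ K) M) hxy
  have hr0 : 0 < r' := by linarith
  have hLn0 : 0 < Ln := by rw [hLndef]; exact_mod_cast Nat.pos_of_ne_zero (pow_ne_zero _ (by omega))
  have hN'eq : N' = Ln * (L : ℝ) ^ K := by rw [hN'def, hLndef]; push_cast; ring
  have hF0 : 0 ≤ (N' / r') ^ (d - 1) := by positivity
  have hR0 : 0 ≤ (Ln / r') ^ (γ / 2) := Real.rpow_nonneg (by positivity) _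
  rcases le_or_gt Ln r' with hres | hlow
  · -- resolved pairs: part S-b
    calc _ ≤ C₀ * (N' / r') ^ (d - 1) * (Ln / r') ^ (γ / 2) := H₀ K hK n hn e M hM msq hmsq hcap x' y' hres
      _ ≤ max C₀ (C₁ + C₂) * (N' / r') ^ (d - 1) * (Ln / r') ^ (γ / 2) :=
          mul_le_mul_of_nonneg_right (mul_le_mul_of_nonneg_right (le_max_left _ _) hF0) hR0
  · -- below the coarse spacing: the fine singularity and the coarse diagonal order, rate factor `≥ 1`
    have hfine := H₁ (K + n) (by omega) (L ^ n * L ^ K) (by rw [pow_add, mul_comm]) e M hM msq hmsq hcap x' y' hxy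
    have hcoarse := H₂ K hK (L ^ K) rfl e M hM msq hmsq hcap (underPtN L K n M x') (underPtN L K n M y')
    have hpow : ((L : ℝ) ^ (K + n)) / r' = N' / r' := by rw [hN'eq, hLndef, pow_add]; push_cast; ring
    rw [hpow] at hfine
    -- `(L^K)^{d−1} ≤ (N′∕r′)^{d−1}` since `r′ < L^n`
    have hKle : (L : ℝ) ^ K ≤ N' / r' := by
      rw [le_div_iff₀ hr0, hN'eq]
      nlinarith [pow_pos (show (0 : ℝ) < L by exact_mod_cast (show 0 < L by omega)) K]
    have hdiag : ((L : ℝ) ^ K) ^ (d - 1) ≤ (N' / r') ^ (d - 1) := pow_le_pow_left₀ (by positivity) hKle _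
    -- the rate factor is `≥ 1`
    have hrate : 1 ≤ (Ln / r') ^ (γ / 2) := Real.one_le_rpow (by rw [le_div_iff₀ hr0, one_mul]; exact hlow.le) (by linarith)
    calc |constrainedProp (L ^ n * L ^ K) M (aK a L (K + n)) (((L ^ n * L ^ K : ℕ) : ℝ) ^ 2) msq x' y'
            - constrainedProp (L ^ K) M (aK a L K) (((L ^ K : ℕ) : ℝ) ^ 2) msq (underPtN L K n M x') (underPtN L K n M y')|
        ≤ |constrainedProp (L ^ n * L ^ K) M (aK a L (K + n)) (((L ^ n * L ^ K : ℕ) : ℝ) ^ 2) msq x' y'|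
            + |constrainedProp (L ^ K) M (aK a L K) (((L ^ K : ℕ) : ℝ) ^ 2) msq (underPtN L K n M x') (underPtN L K n M y')| :=
          abs_sub _ _
      _ ≤ C₁ * (N' / r') ^ (d - 1) + C₂ * ((L : ℝ) ^ K) ^ (d - 1) := add_le_add hfine hcoarse
      _ ≤ C₁ * (N' / r') ^ (d - 1) + C₂ * (N' / r') ^ (d - 1) := by
          have := mul_le_mul_of_nonneg_left hdiag hC₂.le
          linarith
      _ = (C₁ + C₂) * (N' / r') ^ (d - 1) * 1 := by ring
      _ ≤ max C₀ (C₁ + C₂) * (N' / r') ^ (d - 1) * (Ln / r') ^ (γ / 2) :=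
          mul_le_mul (mul_le_mul_of_nonneg_right (le_max_right _ _) hF0) hrate zero_le_one (by positivity)

/-- **THE GRADIENT TWO-SPACING POWER LAW FOR ALL DISTINCT PAIRS** (`d ≥ 1`, `0 ≤ γ < 1`): §1's bound
`|∂G′(x′, y′) − ∂G(x, y)| ≤ C·(L^nL^K∕r′)^{d}·(L^n∕r′)^{γ∕2}` for EVERY `x′ ≠ y′` (resolved pairs: §1; below the coarse spacing: part R-c
`fullPropD_powerLaw_unif` at `K + n` levels and `fullPropD_diag_le_unif`, rate factor `≥ 1`). [cite: King1986, (2.13)–(2.17) p.653, Prop. 3.7 (3.63) p.663, Prop. 3.9 (3.73) p.665] -/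
theorem fullPropD_ratePowerLaw_all (hd : 1 ≤ d) (hLodd : Odd L) (hL : 2 ≤ L) {a : ℝ} (ha : 0 < a) {m0sq : ℝ} (hm0 : 0 ≤ m0sq)
    {γ : ℝ} (hγ0 : 0 ≤ γ) (hγ1 : γ < 1) :
    ∃ C : ℝ, 0 < C ∧ ∀ (K : ℕ), 1 ≤ K → ∀ (n : ℕ), 1 ≤ n →
      ∀ (e : ℕ) (M : Fin (d + 1) → ℕ) [∀ μ, NeZero (M μ)], (∀ μ, M μ = 2 * L ^ e) →
      ∀ (msq : ℝ), 0 < msq → msq ≤ m0sq →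
      ∀ (μ : Fin (d + 1)) (x' y' : Tor (fine (L ^ n * L ^ K) M)), x' ≠ y' →
        |((L ^ n * L ^ K : ℕ) : ℝ) *
              (constrainedProp (L ^ n * L ^ K) M (aK a L (K + n)) (((L ^ n * L ^ K : ℕ) : ℝ) ^ 2) msq
                  (x' + unitVec (fine (L ^ n * L ^ K) M) μ) y'
                - constrainedProp (L ^ n * L ^ K) M (aK a L (K + n)) (((L ^ n * L ^ K : ℕ) : ℝ) ^ 2) msq x' y')
            - ((L ^ K : ℕ) : ℝ) *
              (constrainedProp (L ^ K) M (aK a L K) (((L ^ K : ℕ) : ℝ) ^ 2) msq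
                  (underPtN L K n M x' + unitVec (fine (L ^ K) M) μ) (underPtN L K n M y')
                - constrainedProp (L ^ K) M (aK a L K) (((L ^ K : ℕ) : ℝ) ^ 2) msq
                  (underPtN L K n M x') (underPtN L K n M y'))|
          ≤ C * (((L ^ n * L ^ K : ℕ) : ℝ) / tdistT (fine (L ^ n * L ^ K) M) x' y') ^ d
              * (((L ^ n : ℕ) : ℝ) / tdistT (fine (L ^ n * L ^ K) M) x' y') ^ (γ / 2) := by
  obtain ⟨C₀, hC₀, H₀⟩ := fullPropD_ratePowerLaw_unif (d := d) L hd hLodd hL ha hm0 hγ0 hγ1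
  obtain ⟨C₁, hC₁, H₁⟩ := fullPropD_powerLaw_unif (d := d) L hd hLodd hL ha hm0
  obtain ⟨C₂, hC₂, H₂⟩ := fullPropD_diag_le_unif (d := d) L hd hLodd hL ha hm0
  refine ⟨max C₀ (C₁ + C₂), lt_max_of_lt_left hC₀, ?_⟩
  intro K hK n hn e M _ hM msq hmsq hcap μ x' y' hxy
  set r' : ℝ := tdistT (fine (L ^ n * L ^ K) M) x' y' with hr'def
  set Ln : ℝ := ((L ^ n : ℕ) : ℝ) with hLndef
  set N' : ℝ := ((L ^ n * L ^ K : ℕ) : ℝ) with hN'def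
  have hr1 : 1 ≤ r' := one_le_tdistT_of_ne (fine (L ^ n * L ^ K) M) hxy
  have hr0 : 0 < r' := by linarith
  have hLn0 : 0 < Ln := by rw [hLndef]; exact_mod_cast Nat.pos_of_ne_zero (pow_ne_zero _ (by omega))
  have hN'eq : N' = Ln * (L : ℝ) ^ K := by rw [hN'def, hLndef]; push_cast; ring
  have hF0 : 0 ≤ (N' / r') ^ d := by positivity
  have hR0 : 0 ≤ (Ln / r') ^ (γ / 2) := Real.rpow_nonneg (by positivity) _
  rcases le_or_gt Ln r' with hres | hlow
  · calc _ ≤ C₀ * (N' / r') ^ d * (Ln / r') ^ (γ / 2) := H₀ K hK n hn e M hM msq hmsq hcap μ x' y' hres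
      _ ≤ max C₀ (C₁ + C₂) * (N' / r') ^ d * (Ln / r') ^ (γ / 2) :=
          mul_le_mul_of_nonneg_right (mul_le_mul_of_nonneg_right (le_max_left _ _) hF0) hR0
  · have hfine := H₁ (K + n) (by omega) (L ^ n * L ^ K) (by rw [pow_add, mul_comm]) e M hM msq hmsq hcap μ x' y' hxy
    have hcoarse := H₂ K hK (L ^ K) rfl e M hM msq hmsq hcap μ (underPtN L K n M x') (underPtN L K n M y')
    have hpow : ((L : ℝ) ^ (K + n)) / r' = N' / r' := by rw [hN'eq, hLndef, pow_add]; push_cast; ring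
    rw [hpow] at hfine
    have hKle : (L : ℝ) ^ K ≤ N' / r' := by
      rw [le_div_iff₀ hr0, hN'eq]
      nlinarith [pow_pos (show (0 : ℝ) < L by exact_mod_cast (show 0 < L by omega)) K]
    have hdiag : ((L : ℝ) ^ K) ^ d ≤ (N' / r') ^ d := pow_le_pow_left₀ (by positivity) hKle _
    have hrate : 1 ≤ (Ln / r') ^ (γ / 2) := Real.one_le_rpow (by rw [le_div_iff₀ hr0, one_mul]; exact hlow.le) (by linarith)
    calc |((L ^ n * L ^ K : ℕ) : ℝ) *
              (constrainedProp (L ^ n * L ^ K) M (aK a L (K + n)) (((L ^ n * L ^ K : ℕ) : ℝ) ^ 2) msq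
                  (x' + unitVec (fine (L ^ n * L ^ K) M) μ) y'
                - constrainedProp (L ^ n * L ^ K) M (aK a L (K + n)) (((L ^ n * L ^ K : ℕ) : ℝ) ^ 2) msq x' y')
            - ((L ^ K : ℕ) : ℝ) *
              (constrainedProp (L ^ K) M (aK a L K) (((L ^ K : ℕ) : ℝ) ^ 2) msq
                  (underPtN L K n M x' + unitVec (fine (L ^ K) M) μ) (underPtN L K n M y')
                - constrainedProp (L ^ K) M (aK a L K) (((L ^ K : ℕ) : ℝ) ^ 2) msq
                  (underPtN L K n M x') (underPtN L K n M y'))|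
        ≤ |((L ^ n * L ^ K : ℕ) : ℝ) *
              (constrainedProp (L ^ n * L ^ K) M (aK a L (K + n)) (((L ^ n * L ^ K : ℕ) : ℝ) ^ 2) msq
                  (x' + unitVec (fine (L ^ n * L ^ K) M) μ) y'
                - constrainedProp (L ^ n * L ^ K) M (aK a L (K + n)) (((L ^ n * L ^ K : ℕ) : ℝ) ^ 2) msq x' y')|
            + |((L ^ K : ℕ) : ℝ) *
              (constrainedProp (L ^ K) M (aK a L K) (((L ^ K : ℕ) : ℝ) ^ 2) msq
                  (underPtN L K n M x' + unitVec (fine (L ^ K) M) μ) (underPtN L K n M y')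
                - constrainedProp (L ^ K) M (aK a L K) (((L ^ K : ℕ) : ℝ) ^ 2) msq
                  (underPtN L K n M x') (underPtN L K n M y'))| := abs_sub _ _
      _ ≤ C₁ * (N' / r') ^ d + C₂ * ((L : ℝ) ^ K) ^ d := add_le_add hfine hcoarse
      _ ≤ C₁ * (N' / r') ^ d + C₂ * (N' / r') ^ d := by
          have := mul_le_mul_of_nonneg_left hdiag hC₂.le
          linarith
      _ = (C₁ + C₂) * (N' / r') ^ d * 1 := by ring
      _ ≤ max C₀ (C₁ + C₂) * (N' / r') ^ d * (Ln / r') ^ (γ / 2) :=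
          mul_le_mul (mul_le_mul_of_nonneg_right (le_max_right _ _) hF0) hrate zero_le_one (by positivity)

/-! ## §3 (v1.1, append-only) The `∇_y` twins: the SOURCE-point derivative of the two-spacing difference -/

open Literature.MathematicalPhysics.QuantumFieldTheory.King1986.Torus (tdistT_symm)

/-- **THE `∇_y` TWIN OF THE GRADIENT TWO-SPACING POWER LAW, RESOLVED PAIRS** (`d ≥ 1`, `0 ≤ γ < 1`): the forward η-derivatives in the
SOURCE point, `L^nL^K[G′(x′, y′+e_μ) − G′(x′, y′)]` against `L^K[G(x, y+e_μ) − G(x, y)]` (`x = underPtN x′`, `y = underPtN y′`; the coarse step is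
taken on the coarse lattice), obey §1's bound `C·(L^nL^K∕r′)^{d}·(L^n∕r′)^{γ∕2}` for `r′ ≥ L^n` — both propagators are symmetric (part Q4a
`constrainedProp_symm`) and so is the torus distance, so this IS §1 at the swapped pair `(y′, x′)`.  The spelling «`∇_yG_k(x, y)`» of the (W1)
profile, with the scale-covariant rate factor. [cite: King1986, (2.13) p.653, Prop. 3.9 (3.73) p.665] -/
theorem fullPropD2_ratePowerLaw_unif (hd : 1 ≤ d) (hLodd : Odd L) (hL : 2 ≤ L) {a : ℝ} (ha : 0 < a) {m0sq : ℝ} (hm0 : 0 ≤ m0sq)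
    {γ : ℝ} (hγ0 : 0 ≤ γ) (hγ1 : γ < 1) :
    ∃ C : ℝ, 0 < C ∧ ∀ (K : ℕ), 1 ≤ K → ∀ (n : ℕ), 1 ≤ n →
      ∀ (e : ℕ) (M : Fin (d + 1) → ℕ) [∀ μ, NeZero (M μ)], (∀ μ, M μ = 2 * L ^ e) →
      ∀ (msq : ℝ), 0 < msq → msq ≤ m0sq →
      ∀ (μ : Fin (d + 1)) (x' y' : Tor (fine (L ^ n * L ^ K) M)), ((L ^ n : ℕ) : ℝ) ≤ tdistT (fine (L ^ n * L ^ K) M) x' y' →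
        |((L ^ n * L ^ K : ℕ) : ℝ) *
              (constrainedProp (L ^ n * L ^ K) M (aK a L (K + n)) (((L ^ n * L ^ K : ℕ) : ℝ) ^ 2) msq
                  x' (y' + unitVec (fine (L ^ n * L ^ K) M) μ)
                - constrainedProp (L ^ n * L ^ K) M (aK a L (K + n)) (((L ^ n * L ^ K : ℕ) : ℝ) ^ 2) msq x' y')
            - ((L ^ K : ℕ) : ℝ) *
              (constrainedProp (L ^ K) M (aK a L K) (((L ^ K : ℕ) : ℝ) ^ 2) msq
                  (underPtN L K n M x') (underPtN L K n M y' + unitVec (fine (L ^ K) M) μ)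
                - constrainedProp (L ^ K) M (aK a L K) (((L ^ K : ℕ) : ℝ) ^ 2) msq
                  (underPtN L K n M x') (underPtN L K n M y'))|
          ≤ C * (((L ^ n * L ^ K : ℕ) : ℝ) / tdistT (fine (L ^ n * L ^ K) M) x' y') ^ d
              * (((L ^ n : ℕ) : ℝ) / tdistT (fine (L ^ n * L ^ K) M) x' y') ^ (γ / 2) := by
  obtain ⟨C, hC, H⟩ := fullPropD_ratePowerLaw_unif (d := d) L hd hLodd hL ha hm0 hγ0 hγ1
  refine ⟨C, hC, ?_⟩
  intro K hK n hn e M _ hM msq hmsq hcap μ x' y' hres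
  have h := H K hK n hn e M hM msq hmsq hcap μ y' x' (by rwa [tdistT_symm])
  rw [constrainedProp_symm (L ^ n * L ^ K) M _ _ _ (y' + _) x', constrainedProp_symm (L ^ n * L ^ K) M _ _ _ y' x',
    constrainedProp_symm (L ^ K) M _ _ _ (underPtN L K n M y' + _) (underPtN L K n M x'),
    constrainedProp_symm (L ^ K) M _ _ _ (underPtN L K n M y') (underPtN L K n M x'), tdistT_symm] at h
  exact h

/-- **THE `∇_y` TWIN FOR ALL DISTINCT PAIRS** (`d ≥ 1`, `0 ≤ γ < 1`): §2's `fullPropD_ratePowerLaw_all` with the derivative in the source point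
(symmetry of both propagators and of the distance). [cite: King1986, (2.13) p.653, Prop. 3.9 (3.73) p.665] -/
theorem fullPropD2_ratePowerLaw_all (hd : 1 ≤ d) (hLodd : Odd L) (hL : 2 ≤ L) {a : ℝ} (ha : 0 < a) {m0sq : ℝ} (hm0 : 0 ≤ m0sq)
    {γ : ℝ} (hγ0 : 0 ≤ γ) (hγ1 : γ < 1) :
    ∃ C : ℝ, 0 < C ∧ ∀ (K : ℕ), 1 ≤ K → ∀ (n : ℕ), 1 ≤ n →
      ∀ (e : ℕ) (M : Fin (d + 1) → ℕ) [∀ μ, NeZero (M μ)], (∀ μ, M μ = 2 * L ^ e) →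
      ∀ (msq : ℝ), 0 < msq → msq ≤ m0sq →
      ∀ (μ : Fin (d + 1)) (x' y' : Tor (fine (L ^ n * L ^ K) M)), x' ≠ y' →
        |((L ^ n * L ^ K : ℕ) : ℝ) *
              (constrainedProp (L ^ n * L ^ K) M (aK a L (K + n)) (((L ^ n * L ^ K : ℕ) : ℝ) ^ 2) msq
                  x' (y' + unitVec (fine (L ^ n * L ^ K) M) μ)
                - constrainedProp (L ^ n * L ^ K) M (aK a L (K + n)) (((L ^ n * L ^ K : ℕ) : ℝ) ^ 2) msq x' y')
            - ((L ^ K : ℕ) : ℝ) *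
              (constrainedProp (L ^ K) M (aK a L K) (((L ^ K : ℕ) : ℝ) ^ 2) msq
                  (underPtN L K n M x') (underPtN L K n M y' + unitVec (fine (L ^ K) M) μ)
                - constrainedProp (L ^ K) M (aK a L K) (((L ^ K : ℕ) : ℝ) ^ 2) msq
                  (underPtN L K n M x') (underPtN L K n M y'))|
          ≤ C * (((L ^ n * L ^ K : ℕ) : ℝ) / tdistT (fine (L ^ n * L ^ K) M) x' y') ^ d
              * (((L ^ n : ℕ) : ℝ) / tdistT (fine (L ^ n * L ^ K) M) x' y') ^ (γ / 2) := by
  obtain ⟨C, hC, H⟩ := fullPropD_ratePowerLaw_all (d := d) L hd hLodd hL ha hm0 hγ0 hγ1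
  refine ⟨C, hC, ?_⟩
  intro K hK n hn e M _ hM msq hmsq hcap μ x' y' hxy
  have h := H K hK n hn e M hM msq hmsq hcap μ y' x' (Ne.symm hxy)
  rw [constrainedProp_symm (L ^ n * L ^ K) M _ _ _ (y' + _) x', constrainedProp_symm (L ^ n * L ^ K) M _ _ _ y' x',
    constrainedProp_symm (L ^ K) M _ _ _ (underPtN L K n M y' + _) (underPtN L K n M x'),
    constrainedProp_symm (L ^ K) M _ _ _ (underPtN L K n M y') (underPtN L K n M x'), tdistT_symm] at h
  exact h

end Summit.QuantumFields.YangMills.BalabanUVNodes.N15KingModelRung.Curved
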